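import Mathlib.Algebra.BigOperators.Fin
import Mathlib.Algebra.Group.Units.Equiv
import Mathlib.Data.Fintype.BigOperators
import Literature.Computability.QuantumComplexity.ShallowCircuitsQuadForm
import Literature.Computability.QuantumComplexity.ShallowCircuitsGame
import HarnessLib

/-!
# Necklaces: even cycles in the grid with three hubs, and the parities of HLF solutions

Trunk `CryptoQuantFine` / family `quantum-advantage`. The instances of the 2D Hidden Linear
Function problem used in the classical lower bound of Bravyi–Gosset–König (*Quantum advantage
with shallow circuits*, Science 362 (2018), arXiv:1704.00690, §4): an even cycle `Γ` of length
`2m` embedded in the `N × N` grid (`Necklace N m`, positions `Fin m × Bool`, position `2t` being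
`(t, false)` and `2t + 1` being `(t, true)`), three hubs `u, v, w` at even positions, and the `8`
instances `Necklace.hlfInstance Γ β` with `A` the adjacency matrix of the cycle and `b = β` on the hubs
(BGK Eq. (31); numbering of arXiv:1704.00690v1 throughout).

## Main result

`Necklace.gameOK`: every solution `z ∈ hlfSolutions (Γ.hlfInstance β)` satisfies, along the cycle, the
parity constraints `GameOK` of the cycle game (`ShallowCircuitsGame`): the sum of `z` over the odd
positions is even, and for `|β|` even the sum of `z` over the even positions and the odd
positions of the `β`-selected sides is `[β ≠ 0] (mod 2)`. This is BGK Claim 3 (the possible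
measurement outcomes `𝒯(b)` and their stabiliser parities, Eq. (19)–(20)) expressed directly for
HLF solutions: the indicator vectors `1_odd` and `1_{even ∪ selected odd}` lie in the binary
kernel of `A_Γ + diag b` (`nKer_oddSet_even`, `nKer_arcSet_even`), hence in `L_q`
(`ShallowCircuitsQuadForm`), and evaluating `q = 2 zᵀx` on them (`solution_congr`, counting
edges `nE` and hubs `nB` inside the support) gives the parities. No quantum formalism is needed.

The last section records the positions `bIdx` of the hub bits in the input string of a classical
circuit and the fact that the inputs of two necklace instances differ only there
(`necklace_input_congr`).

## References

* S. Bravyi, D. Gosset, R. König, *Quantum advantage with shallow circuits*, Science 362 (2018)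
  308–311, arXiv:1704.00690, §4.1 (Fig. 2, Eq. (19)–(20), Claim 3), §4.2 (Eq. (31)–(32)).
  Section, claim, figure and equation numbers are those of arXiv:1704.00690v1.
-/

namespace Literature.Computability.QuantumComplexity

open Finset

variable {N m : ℕ} [NeZero m]

/-! ### The abstract necklace (even cycle) on `Fin m × Bool` -/

/-- Adjacency of the abstract cycle of length `2m` on the vertex set `Fin m × Bool`, position
`2t` being `(t, false)` and position `2t + 1` being `(t, true)`: `(t, false) ∼ (t, true)` and
`(t, true) ∼ (t + 1, false)`. (Bravyi–Gosset–König 2018, §4.1: the even cycle `Γ`.) [cite: BravyiGossetKonigScience2018, §4.1] -/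
def NAdj (p q : Fin m × Bool) : Prop :=
  (p.2 = false ∧ q.2 = true ∧ (q.1 = p.1 ∨ q.1 + 1 = p.1)) ∨
    (p.2 = true ∧ q.2 = false ∧ (p.1 = q.1 ∨ p.1 + 1 = q.1))

/-- Cycle adjacency is decidable (it is a Boolean combination of equalities in `Fin m`). [folklore] -/
instance NAdj.decidableRel : DecidableRel (NAdj (m := m)) := fun p q => by
  unfold NAdj; infer_instance

/-- Cycle adjacency is symmetric. [folklore] -/
theorem nAdj_comm {p q : Fin m × Bool} : NAdj p q ↔ NAdj q p := by
  unfold NAdj; tauto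

/-- An even cycle of length `2m` embedded in the `N × N` grid (injectively, consecutive
positions being grid neighbours), with three hubs at the even positions `(hub i, false)`,
`hub 0 < hub 1 < hub 2` (the vertices `u, v, w` of BGK's triangle, Fig. 2; all pairwise
distances along the cycle are even). (Bravyi–Gosset–König 2018, §4.1–4.2.) [cite: BravyiGossetKonigScience2018, §4.1] -/
structure Necklace (N m : ℕ) [NeZero m] where
  /-- The embedding of the positions into the grid. -/
  toFun : Fin m × Bool → Fin N × Fin N
  /-- The embedding is injective (the cycle is simple). -/
  injective : Function.Injective toFun
  /-- Consecutive positions are grid neighbours. -/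
  adj : ∀ p q, NAdj p q → (gridGraph N).Adj (toFun p) (toFun q)
  /-- The three hubs `u = hub 0`, `v = hub 1`, `w = hub 2` (even positions `(hub i, false)`). -/
  hub : Fin 3 → Fin m
  /-- The hubs are met in the order `u, v, w` along the cycle. -/
  hub_lt₀₁ : hub 0 < hub 1
  /-- The hubs are met in the order `u, v, w` along the cycle. -/
  hub_lt₁₂ : hub 1 < hub 2

namespace Necklace

variable (Γ : Necklace N m)

/-- The side of the triangle containing the odd position `(t, true)`, named by the *opposite*
hub: `2` (side `L = (u, v)`, opposite `w`) if `hub 0 ≤ t < hub 1`, `0` (side `R = (v, w)`,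
opposite `u`) if `hub 1 ≤ t < hub 2`, and `1` (side `B = (w, u)`, opposite `v`) otherwise.
(Bravyi–Gosset–König 2018, Fig. 2.) [cite: BravyiGossetKonigScience2018, §4.1 Fig. 2] -/
def arcOf (t : Fin m) : Fin 3 :=
  if t < Γ.hub 0 then 1 else if t < Γ.hub 1 then 2 else if t < Γ.hub 2 then 0 else 1

/-- The class of a position for the cycle game (`ShallowCircuitsGame`): `none` for even
positions, `some (arcOf t)` for the odd position `(t, true)`. (Bravyi–Gosset–König 2018,
§4.1.) [cite: BravyiGossetKonigScience2018, §4.1] -/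
def cls (p : Fin m × Bool) : Option (Fin 3) := if p.2 = true then some (Γ.arcOf p.1) else none

/-- The 2D HLF instance attached to a necklace and a setting `β ∈ {0,1}³`: `A` is the adjacency
matrix of the embedded cycle and `b = β` on the three hubs, `0` elsewhere.
(Bravyi–Gosset–König 2018, §4.2, Eq. (31).) [cite: BravyiGossetKonigScience2018, §4.2 Eq. (31)] -/
def hlfInstance (β : Fin 3 → Bool) : HLFInstance N where
  A a a' := decide (∃ p q : Fin m × Bool, NAdj p q ∧ Γ.toFun p = a ∧ Γ.toFun q = a')
  b a := decide (∃ i : Fin 3, β i = true ∧ Γ.toFun (Γ.hub i, false) = a)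

/-- The indicator vector of the image of a set of positions. [folklore] -/
def ind (S : Finset (Fin m × Bool)) : Fin N × Fin N → Bool :=
  fun a => decide (∃ p ∈ S, Γ.toFun p = a)

variable {Γ}

/-- The cycle matrix on embedded positions is the abstract cycle adjacency. [folklore] -/
theorem hlfInstance_A_apply (β : Fin 3 → Bool) (p q : Fin m × Bool) :
    (Γ.hlfInstance β).A (Γ.toFun p) (Γ.toFun q) = true ↔ NAdj p q := by
  simp only [hlfInstance, decide_eq_true_eq]
  constructor
  · rintro ⟨p', q', h, hp, hq⟩
    rw [← Γ.injective hp, ← Γ.injective hq]; exact h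
  · intro h; exact ⟨p, q, h, rfl, rfl⟩

/-- Entries of the cycle matrix are supported on embedded positions. [folklore] -/
theorem hlfInstance_A_eq_true {β : Fin 3 → Bool} {a a' : Fin N × Fin N} (h : (Γ.hlfInstance β).A a a' = true) :
    ∃ p q, NAdj p q ∧ Γ.toFun p = a ∧ Γ.toFun q = a' := by
  simpa [hlfInstance] using h

/-- The linear part on embedded positions: `β` on the hubs. [folklore] -/
theorem hlfInstance_b_apply (β : Fin 3 → Bool) (p : Fin m × Bool) :
    (Γ.hlfInstance β).b (Γ.toFun p) = true ↔ ∃ i, β i = true ∧ p = (Γ.hub i, false) := by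
  simp only [hlfInstance, decide_eq_true_eq]
  constructor
  · rintro ⟨i, hi, hp⟩; exact ⟨i, hi, (Γ.injective hp).symm⟩
  · rintro ⟨i, hi, rfl⟩; exact ⟨i, hi, rfl⟩

/-- The linear part is supported on the hubs. [folklore] -/
theorem hlfInstance_b_eq_true {β : Fin 3 → Bool} {a : Fin N × Fin N} (h : (Γ.hlfInstance β).b a = true) :
    ∃ i, β i = true ∧ Γ.toFun (Γ.hub i, false) = a := by
  simpa [hlfInstance] using h

/-- Necklace instances are valid 2D HLF instances (symmetric, supported on grid edges); immediate
from the definition (BGK Eq. (31) introduces them as instances of the 2D HLF problem). [folklore] -/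
theorem hlfInstance_isValid (β : Fin 3 → Bool) : (Γ.hlfInstance β).IsValid := by
  constructor
  · intro a a'
    simp only [hlfInstance]
    rw [decide_eq_decide]
    constructor <;> rintro ⟨p, q, h, hp, hq⟩ <;> exact ⟨q, p, nAdj_comm.mp h, hq, hp⟩
  · intro a a' h
    obtain ⟨p, q, hpq, rfl, rfl⟩ := hlfInstance_A_eq_true h
    exact Γ.adj p q hpq

/-- The indicator of `S` at an embedded position. [folklore] -/
theorem ind_apply (S : Finset (Fin m × Bool)) (p : Fin m × Bool) :
    Γ.ind S (Γ.toFun p) = true ↔ p ∈ S := by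
  simp only [ind, decide_eq_true_eq]
  constructor
  · rintro ⟨p', hp', h⟩; rwa [← Γ.injective h]
  · intro h; exact ⟨p, h, rfl⟩

/-- The indicator of `S` is supported on embedded positions. [folklore] -/
theorem ind_eq_true {S : Finset (Fin m × Bool)} {a : Fin N × Fin N} (h : Γ.ind S a = true) :
    ∃ p ∈ S, Γ.toFun p = a := by
  simpa [ind] using h

/-- Transport of sums: a function on the grid vanishing off the necklace is summed over the
positions. [folklore] -/
theorem sum_eq_sum_toFun {M : Type*} [AddCommMonoid M] (Γ : Necklace N m) (f : Fin N × Fin N → M)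
    (hf : ∀ a, (∀ p, Γ.toFun p ≠ a) → f a = 0) : ∑ a, f a = ∑ p, f (Γ.toFun p) := by
  classical
  calc ∑ a, f a = ∑ a ∈ univ.image Γ.toFun, f a := by
        symm
        apply Finset.sum_subset (Finset.subset_univ _)
        intro a _ ha
        apply hf
        intro p hp
        exact ha (hp ▸ mem_image_of_mem _ (mem_univ p))
    _ = ∑ p, f (Γ.toFun p) := Finset.sum_image fun p _ q _ h => Γ.injective h

/-! ### Counting on the abstract necklace -/

/-- The kernel count `((A + diag b) 1_S)_q` on the abstract necklace: the number of cycle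
neighbours of `q` in `S`, plus `1` if `q ∈ S` is a hub with `β = 1`. [folklore] -/
def nKer (Γ : Necklace N m) (S : Finset (Fin m × Bool)) (β : Fin 3 → Bool) (q : Fin m × Bool) : ℕ :=
  (∑ p, if NAdj p q ∧ p ∈ S then 1 else 0) +
    if (∃ i, β i = true ∧ q = (Γ.hub i, false)) ∧ q ∈ S then 1 else 0

/-- Twice the number of cycle edges inside `S` (ordered adjacent pairs in `S`). [folklore] -/
def nE (S : Finset (Fin m × Bool)) : ℕ := ∑ p, ∑ q, if NAdj p q ∧ p ∈ S ∧ q ∈ S then 1 else 0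

/-- The number of hubs in `S` with `β = 1`. [folklore] -/
def nB (Γ : Necklace N m) (S : Finset (Fin m × Bool)) (β : Fin 3 → Bool) : ℕ :=
  ∑ p, if (∃ i, β i = true ∧ p = (Γ.hub i, false)) ∧ p ∈ S then 1 else 0

/-- The number of positions in `S` where the output `z` is `1`. [folklore] -/
def nZ (Γ : Necklace N m) (S : Finset (Fin m × Bool)) (z : Fin N × Fin N → Bool) : ℕ :=
  ∑ p, if z (Γ.toFun p) = true ∧ p ∈ S then 1 else 0

/-- Transport of the kernel count to the abstract necklace. [folklore] -/
theorem kerCount_ind_toFun (β : Fin 3 → Bool) (S : Finset (Fin m × Bool)) (q : Fin m × Bool) :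
    (Γ.hlfInstance β).kerCount (Γ.ind S) (Γ.toFun q) = Γ.nKer S β q := by
  unfold HLFInstance.kerCount nKer
  congr 1
  · rw [Finset.card_filter, Γ.sum_eq_sum_toFun]
    · refine Finset.sum_congr rfl fun p _ => ?_
      simp only [hlfInstance_A_apply, ind_apply]
    · intro a ha
      rw [if_neg]
      rintro ⟨-, h⟩
      obtain ⟨p, -, rfl⟩ := ind_eq_true h
      exact ha p rfl
  · simp only [hlfInstance_b_apply, ind_apply]

/-- Off the necklace the kernel count vanishes. [folklore] -/
theorem kerCount_ind_eq_zero (β : Fin 3 → Bool) (S : Finset (Fin m × Bool)) (a : Fin N × Fin N)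
    (ha : ∀ p, Γ.toFun p ≠ a) : (Γ.hlfInstance β).kerCount (Γ.ind S) a = 0 := by
  unfold HLFInstance.kerCount
  rw [Finset.card_eq_zero.mpr, if_neg, add_zero]
  · rintro ⟨h, -⟩
    obtain ⟨i, -, hi⟩ := hlfInstance_b_eq_true h
    exact ha _ hi
  · rw [Finset.filter_eq_empty_iff]
    rintro u - ⟨h, -⟩
    obtain ⟨p, q, -, -, hq⟩ := hlfInstance_A_eq_true h
    exact ha q hq

/-- **The solution identity on a necklace.** If `1_S` lies in the kernel of `A + diag b` on the
abstract necklace, then for every solution `z` of the necklace instance,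
`nE S + nB S β ≡ 2 nZ S z (mod 4)`: the defining property `q(1_S) = 2 zᵀ1_S` of a solution
(§3, Lemma 1 and the problem statement following it; Eq. (2) of the Science text) with `q(1_S)`
evaluated by counting edges and hubs inside `S`. (The HLF-side
counterpart of the stabiliser computations in the proof of BGK Claim 3; not printed in BGK in
this form.) [folklore] -/
theorem solution_congr (β : Fin 3 → Bool) (S : Finset (Fin m × Bool))
    (hS : ∀ q, Even (Γ.nKer S β q)) {z : Fin N × Fin N → Bool}
    (hz : z ∈ hlfSolutions (Γ.hlfInstance β)) :
    (nE S + Γ.nB S β) % 4 = (2 * Γ.nZ S z) % 4 := by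
  have hx : ∀ v, Even ((Γ.hlfInstance β).kerCount (Γ.ind S) v) := by
    intro v
    by_cases hv : ∃ p, Γ.toFun p = v
    · obtain ⟨q, rfl⟩ := hv
      rw [kerCount_ind_toFun]; exact hS q
    · rw [kerCount_ind_eq_zero β S v (fun p h => hv ⟨p, h⟩)]; exact Even.zero
  have key := HLFInstance.solution_identity (Γ.hlfInstance β) (hlfInstance_isValid β) hz hx
  rw [← ZMod.natCast_eq_natCast_iff', Nat.cast_add, Nat.cast_mul, Nat.cast_ofNat]
  convert key using 2
  · -- quadratic part
    unfold nE
    rw [Nat.cast_sum, Γ.sum_eq_sum_toFun]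
    · refine Finset.sum_congr rfl fun p _ => ?_
      rw [Nat.cast_sum, Γ.sum_eq_sum_toFun]
      · refine Finset.sum_congr rfl fun q _ => ?_
        simp only [Nat.cast_ite, Nat.cast_one, Nat.cast_zero, hlfInstance_A_apply, ind_apply]
      · intro a ha
        rw [if_neg]
        rintro ⟨-, -, h⟩
        obtain ⟨q, -, rfl⟩ := ind_eq_true h
        exact ha q rfl
    · intro a ha
      apply Finset.sum_eq_zero
      intro v _
      rw [if_neg]
      rintro ⟨-, h, -⟩
      obtain ⟨q, -, rfl⟩ := ind_eq_true h
      exact ha q rfl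
  · -- linear part
    unfold nB
    rw [Nat.cast_sum, Γ.sum_eq_sum_toFun]
    · refine Finset.sum_congr rfl fun p _ => ?_
      simp only [Nat.cast_ite, Nat.cast_one, Nat.cast_zero, hlfInstance_b_apply, ind_apply]
    · intro a ha
      rw [if_neg]
      rintro ⟨-, h⟩
      obtain ⟨q, -, rfl⟩ := ind_eq_true h
      exact ha q rfl
  · -- solution count
    unfold nZ
    rw [Finset.card_filter, Nat.cast_sum, Nat.cast_sum, Γ.sum_eq_sum_toFun]
    · refine Finset.sum_congr rfl fun p _ => ?_
      simp only [Nat.cast_ite, Nat.cast_one, Nat.cast_zero, ind_apply]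
    · intro a ha
      rw [if_neg, Nat.cast_zero]
      rintro ⟨-, h⟩
      obtain ⟨q, -, rfl⟩ := ind_eq_true h
      exact ha q rfl

/-! ### Arithmetic on the abstract necklace -/

/-- A necklace with three hubs has at least three even positions. [folklore] -/
theorem three_le (Γ : Necklace N m) : 3 ≤ m := by
  have h1 := Fin.lt_def.mp Γ.hub_lt₀₁
  have h2 := Fin.lt_def.mp Γ.hub_lt₁₂
  have h3 := (Γ.hub 2).isLt
  omega

/-- On a necklace, `1 ≠ 0` in `Fin m`. [folklore] -/
theorem one_ne_zero (Γ : Necklace N m) : (1 : Fin m) ≠ 0 := by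
  rw [Ne, Fin.one_eq_zero_iff]
  have := Γ.three_le
  omega

/-- The successor of a position is a different position. [folklore] -/
theorem add_one_ne (Γ : Necklace N m) (t : Fin m) : t + 1 ≠ t :=
  fun h => Γ.one_ne_zero (add_eq_left.mp h)

/-- The predecessor of a position is a different position. [folklore] -/
theorem sub_one_ne (Γ : Necklace N m) (t : Fin m) : t - 1 ≠ t :=
  fun h => Γ.one_ne_zero (sub_eq_self.mp h)

/-- The value of the predecessor of a position. [folklore] -/
theorem val_sub_one (Γ : Necklace N m) (t : Fin m) :
    ((t - 1 : Fin m).val = m - 1 ∧ t.val = 0) ∨ ((t - 1 : Fin m).val = t.val - 1 ∧ 0 < t.val) := by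
  have h3 := Γ.three_le
  rw [Fin.val_sub, Fin.val_one', Nat.mod_eq_of_lt (show 1 < m by omega)]
  by_cases h : t.val = 0
  · left
    rw [h, Nat.add_zero, Nat.mod_eq_of_lt (by omega)]
    exact ⟨rfl, rfl⟩
  · right
    rw [show m - 1 + t.val = (t.val - 1) + m by omega, Nat.add_mod_right,
      Nat.mod_eq_of_lt (by omega)]
    exact ⟨rfl, by omega⟩

/-- The hubs are pairwise distinct. [folklore] -/
theorem hub_injective (Γ : Necklace N m) : Function.Injective Γ.hub := by
  have h1 := Fin.lt_def.mp Γ.hub_lt₀₁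
  have h2 := Fin.lt_def.mp Γ.hub_lt₁₂
  intro i j h
  have h' := congrArg Fin.val h
  fin_cases i <;> fin_cases j <;> simp at h' ⊢ <;> omega

omit [NeZero m] in
/-- A two-point indicator sum. [folklore] -/
theorem sum_ite_or_eq {t₁ t₂ : Fin m} (h : t₁ ≠ t₂) (P : Fin m → Prop) [DecidablePred P] :
    (∑ t, if (t = t₁ ∨ t = t₂) ∧ P t then 1 else 0 : ℕ) =
      (if P t₁ then 1 else 0) + (if P t₂ then 1 else 0) := by
  have key : ∀ t, (if (t = t₁ ∨ t = t₂) ∧ P t then 1 else 0 : ℕ) =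
      (if t = t₁ then (if P t then 1 else 0) else 0) +
        (if t = t₂ then (if P t then 1 else 0) else 0) := by
    intro t
    by_cases h1 : t = t₁
    · subst h1; simp [h]
    · by_cases h2 : t = t₂
      · subst h2; simp [h1]
      · simp [h1, h2]
  simp_rw [key, Finset.sum_add_distrib, Finset.sum_ite_eq', mem_univ, if_true]

/-- The neighbours of the even position `(t, false)` in `S`: `(t, true)` and `(t - 1, true)`. [folklore] -/
theorem sum_nAdj_even (Γ : Necklace N m) (S : Finset (Fin m × Bool)) (t : Fin m) :
    (∑ p, if NAdj p (t, false) ∧ p ∈ S then 1 else 0 : ℕ) =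
      (if (t, true) ∈ S then 1 else 0) + (if (t - 1, true) ∈ S then 1 else 0) := by
  rw [Fintype.sum_prod_type]
  simp_rw [Fintype.sum_bool]
  have h0 : ∀ t' : Fin m, ¬ (NAdj (t', false) (t, false)) := by
    intro t'; simp [NAdj]
  have h1 : ∀ t' : Fin m, NAdj (t', true) (t, false) ↔ (t' = t ∨ t' = t - 1) := by
    intro t'; simp [NAdj, eq_sub_iff_add_eq]
  simp_rw [h0, false_and, if_false, add_zero, h1]
  exact sum_ite_or_eq (Γ.sub_one_ne t).symm fun t' => (t', true) ∈ S

/-- The neighbours of the odd position `(t, true)` in `S`: `(t, false)` and `(t + 1, false)`. [folklore] -/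
theorem sum_nAdj_odd (Γ : Necklace N m) (S : Finset (Fin m × Bool)) (t : Fin m) :
    (∑ p, if NAdj p (t, true) ∧ p ∈ S then 1 else 0 : ℕ) =
      (if (t, false) ∈ S then 1 else 0) + (if (t + 1, false) ∈ S then 1 else 0) := by
  rw [Fintype.sum_prod_type]
  simp_rw [Fintype.sum_bool]
  have h0 : ∀ t' : Fin m, ¬ (NAdj (t', true) (t, true)) := by
    intro t'; simp [NAdj]
  have h1 : ∀ t' : Fin m, NAdj (t', false) (t, true) ↔ (t' = t ∨ t' = t + 1) := by
    intro t'; simp only [NAdj]; constructor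
    · rintro (⟨-, -, h | h⟩ | ⟨h, -⟩)
      · exact Or.inl h.symm
      · exact Or.inr h.symm
      · exact absurd h (by simp)
    · rintro (rfl | rfl) <;> simp
  simp_rw [h0, false_and, if_false, zero_add, h1]
  exact sum_ite_or_eq (Γ.add_one_ne t).symm fun t' => (t', false) ∈ S

/-- The double edge count as a sum of neighbour counts over `S`. [folklore] -/
theorem nE_eq (S : Finset (Fin m × Bool)) :
    nE S = ∑ p, if p ∈ S then (∑ q, if NAdj q p ∧ q ∈ S then 1 else 0 : ℕ) else 0 := by
  unfold nE
  refine Finset.sum_congr rfl fun p _ => ?_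
  by_cases hp : p ∈ S
  · rw [if_pos hp]
    refine Finset.sum_congr rfl fun q _ => ?_
    simp [hp, nAdj_comm]
  · rw [if_neg hp]
    exact Finset.sum_eq_zero fun q _ => by simp [hp]

/-! ### The side structure -/

/-- Away from the hubs, consecutive positions lie on the same side. [folklore] -/
theorem arcOf_sub_one (t : Fin m) (ht : ∀ i, t ≠ Γ.hub i) : Γ.arcOf (t - 1) = Γ.arcOf t := by
  have h1 := Fin.lt_def.mp Γ.hub_lt₀₁
  have h2 := Fin.lt_def.mp Γ.hub_lt₁₂
  have h3 := (Γ.hub 2).isLt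
  have ht0 : t.val ≠ (Γ.hub 0).val := fun h => ht 0 (Fin.ext h)
  have ht1 : t.val ≠ (Γ.hub 1).val := fun h => ht 1 (Fin.ext h)
  have ht2 : t.val ≠ (Γ.hub 2).val := fun h => ht 2 (Fin.ext h)
  unfold arcOf
  simp only [Fin.lt_def]
  rcases Γ.val_sub_one t with ⟨hv, h0⟩ | ⟨hv, h0⟩ <;> rw [hv] <;>
    split_ifs <;> first | rfl | (exfalso; omega)

/-- The side starting at `u = hub 0` is `L = 2`. [folklore] -/
theorem arcOf_hub₀ : Γ.arcOf (Γ.hub 0) = 2 := by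
  have h1 := Fin.lt_def.mp Γ.hub_lt₀₁
  unfold arcOf
  simp only [Fin.lt_def]
  split_ifs <;> first | rfl | (exfalso; omega)

/-- The side starting at `v = hub 1` is `R = 0`. [folklore] -/
theorem arcOf_hub₁ : Γ.arcOf (Γ.hub 1) = 0 := by
  have h1 := Fin.lt_def.mp Γ.hub_lt₀₁
  have h2 := Fin.lt_def.mp Γ.hub_lt₁₂
  unfold arcOf
  simp only [Fin.lt_def]
  split_ifs <;> first | rfl | (exfalso; omega)

/-- The side starting at `w = hub 2` is `B = 1`. [folklore] -/
theorem arcOf_hub₂ : Γ.arcOf (Γ.hub 2) = 1 := by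
  have h1 := Fin.lt_def.mp Γ.hub_lt₀₁
  have h2 := Fin.lt_def.mp Γ.hub_lt₁₂
  unfold arcOf
  simp only [Fin.lt_def]
  split_ifs <;> first | rfl | (exfalso; omega)

/-- The side ending at `u = hub 0` is `B = 1`. [folklore] -/
theorem arcOf_hub₀_sub_one : Γ.arcOf (Γ.hub 0 - 1) = 1 := by
  have h1 := Fin.lt_def.mp Γ.hub_lt₀₁
  have h2 := Fin.lt_def.mp Γ.hub_lt₁₂
  have h3 := (Γ.hub 2).isLt
  unfold arcOf
  simp only [Fin.lt_def]
  rcases Γ.val_sub_one (Γ.hub 0) with ⟨hv, h0⟩ | ⟨hv, h0⟩ <;> rw [hv] <;>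
    split_ifs <;> first | rfl | (exfalso; omega)

/-- The side ending at `v = hub 1` is `L = 2`. [folklore] -/
theorem arcOf_hub₁_sub_one : Γ.arcOf (Γ.hub 1 - 1) = 2 := by
  have h1 := Fin.lt_def.mp Γ.hub_lt₀₁
  have h2 := Fin.lt_def.mp Γ.hub_lt₁₂
  have h3 := (Γ.hub 2).isLt
  unfold arcOf
  simp only [Fin.lt_def]
  rcases Γ.val_sub_one (Γ.hub 1) with ⟨hv, h0⟩ | ⟨hv, h0⟩ <;> rw [hv] <;>
    split_ifs <;> first | rfl | (exfalso; omega)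

/-- The side ending at `w = hub 2` is `R = 0`. [folklore] -/
theorem arcOf_hub₂_sub_one : Γ.arcOf (Γ.hub 2 - 1) = 0 := by
  have h1 := Fin.lt_def.mp Γ.hub_lt₀₁
  have h2 := Fin.lt_def.mp Γ.hub_lt₁₂
  have h3 := (Γ.hub 2).isLt
  unfold arcOf
  simp only [Fin.lt_def]
  rcases Γ.val_sub_one (Γ.hub 2) with ⟨hv, h0⟩ | ⟨hv, h0⟩ <;> rw [hv] <;>
    split_ifs <;> first | rfl | (exfalso; omega)

/-- At a hub, the two adjacent sides and the hub's own index exhaust `Fin 3`, so the indicator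
sum of `β` over them is the weight of `β`. [folklore] -/
theorem hub_sides_sum (β : Fin 3 → Bool) (i : Fin 3) :
    (if β (Γ.arcOf (Γ.hub i)) = true then 1 else 0) +
        (if β (Γ.arcOf (Γ.hub i - 1)) = true then 1 else 0) + (if β i = true then 1 else 0) =
      (univ.filter fun a => β a = true).card := by
  rw [Finset.card_filter, Fin.sum_univ_three]
  fin_cases i
  · show (if β (Γ.arcOf (Γ.hub 0)) = true then 1 else 0) +
        (if β (Γ.arcOf (Γ.hub 0 - 1)) = true then 1 else 0) + (if β 0 = true then 1 else 0) = _
    rw [arcOf_hub₀, arcOf_hub₀_sub_one]; omega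
  · show (if β (Γ.arcOf (Γ.hub 1)) = true then 1 else 0) +
        (if β (Γ.arcOf (Γ.hub 1 - 1)) = true then 1 else 0) + (if β 1 = true then 1 else 0) = _
    rw [arcOf_hub₁, arcOf_hub₁_sub_one]; omega
  · show (if β (Γ.arcOf (Γ.hub 2)) = true then 1 else 0) +
        (if β (Γ.arcOf (Γ.hub 2 - 1)) = true then 1 else 0) + (if β 2 = true then 1 else 0) = _
    rw [arcOf_hub₂, arcOf_hub₂_sub_one]; omega

/-! ### The two families of test vectors -/

/-- The odd positions. [folklore] -/
def oddSet (m : ℕ) : Finset (Fin m × Bool) := univ.filter fun p => p.2 = true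

/-- The even positions together with the odd positions of the sides opposite the hubs `a` with
`β_a = 1`: for `|β|` even these are the supports `{u,v,w} ∪ R_even ∪ L_even ∪ B_even`,
`{u,v,w} ∪ R ∪ B ∪ L_even`, … of the four stabilisers listed in the proof of BGK Claim 3 (side `R`
is opposite `u`, `B` opposite `v`, `L` opposite `w`). [cite: BravyiGossetKonigScience2018, §4.1 Claim 3 (proof)] -/
def arcSet (Γ : Necklace N m) (β : Fin 3 → Bool) : Finset (Fin m × Bool) :=
  univ.filter fun p => p.2 = false ∨ β (Γ.arcOf p.1) = true

omit [NeZero m] in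
/-- Membership in the odd set. [folklore] -/
@[simp] theorem mem_oddSet (p : Fin m × Bool) : p ∈ oddSet m ↔ p.2 = true := by
  simp [oddSet]

/-- Membership in the arc set. [folklore] -/
@[simp] theorem mem_arcSet (β : Fin 3 → Bool) (p : Fin m × Bool) :
    p ∈ Γ.arcSet β ↔ p.2 = false ∨ β (Γ.arcOf p.1) = true := by
  simp [arcSet]

/-- `1_odd` lies in the kernel of `A + diag b`. [folklore] -/
theorem nKer_oddSet_even (β : Fin 3 → Bool) (q : Fin m × Bool) : Even (Γ.nKer (oddSet m) β q) := by
  obtain ⟨t, b⟩ := q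
  unfold nKer
  cases b
  · rw [Γ.sum_nAdj_even]
    simp
  · rw [Γ.sum_nAdj_odd]
    simp

/-- No cycle edge joins two odd positions. [folklore] -/
theorem nE_oddSet (Γ : Necklace N m) : nE (oddSet m) = 0 := by
  rw [nE_eq]
  refine Finset.sum_eq_zero fun p _ => ?_
  obtain ⟨t, b⟩ := p
  cases b
  · simp
  · rw [Γ.sum_nAdj_odd]; simp

/-- No hub is odd. [folklore] -/
theorem nB_oddSet (β : Fin 3 → Bool) : Γ.nB (oddSet m) β = 0 := by
  unfold nB
  refine Finset.sum_eq_zero fun p _ => ?_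
  rw [if_neg]
  rintro ⟨⟨i, -, rfl⟩, h⟩
  simp at h

/-- `1_{arcSet β}` lies in the kernel of `A + diag b` when `|β|` is even: every position has an
even number of cycle neighbours in `arcSet β` once the hub term `b` is added. (The HLF-side
counterpart of "the four operators in the proof of BGK Claim 3 are stabilisers"; not printed in
BGK in this form.) [folklore] -/
theorem nKer_arcSet_even (β : Fin 3 → Bool) (hβ : Even (univ.filter fun a => β a = true).card)
    (q : Fin m × Bool) : Even (Γ.nKer (Γ.arcSet β) β q) := by
  obtain ⟨t, b⟩ := q
  unfold nKer
  cases b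
  · rw [Γ.sum_nAdj_even]
    simp only [mem_arcSet, Bool.true_eq_false, false_or, true_or, and_true, Prod.mk.injEq]
    by_cases ht : ∃ i, t = Γ.hub i
    · obtain ⟨i, rfl⟩ := ht
      have hh : (∃ i', β i' = true ∧ Γ.hub i = Γ.hub i') ↔ β i = true := by
        constructor
        · rintro ⟨i', h, e⟩; rwa [Γ.hub_injective e]
        · intro h; exact ⟨i, h, rfl⟩
      simp only [hh]
      rw [Γ.hub_sides_sum β i]
      exact hβ
    · have ht' : ∀ i, t ≠ Γ.hub i := fun i h => ht ⟨i, h⟩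
      have hne : ¬ (∃ i, β i = true ∧ t = Γ.hub i) := fun ⟨i, _, h⟩ => ht' i h
      rw [Γ.arcOf_sub_one t ht', if_neg hne, add_zero]
      by_cases h : β (Γ.arcOf t) = true <;> simp [h]
  · rw [Γ.sum_nAdj_odd]
    simp

/-- The number of odd positions on `β`-selected sides. [folklore] -/
def nSel (Γ : Necklace N m) (β : Fin 3 → Bool) : ℕ := (univ.filter fun t => β (Γ.arcOf t) = true).card

/-- Twice the number of cycle edges inside `arcSet β` is `4 · nSel β` (every selected odd
position contributes its two edges, each counted twice). [folklore] -/
theorem nE_arcSet (β : Fin 3 → Bool) : nE (Γ.arcSet β) = 4 * Γ.nSel β := by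
  rw [nE_eq, Fintype.sum_prod_type]
  simp_rw [Fintype.sum_bool, Γ.sum_nAdj_odd, Γ.sum_nAdj_even]
  simp only [mem_arcSet, Bool.true_eq_false, false_or, true_or, if_true]
  have h1 : ∀ t : Fin m, (if β (Γ.arcOf t) = true then (1 + 1 : ℕ) else 0) =
      2 * (if β (Γ.arcOf t) = true then 1 else 0) := by
    intro t; split_ifs <;> rfl
  simp_rw [h1, Finset.sum_add_distrib, ← Finset.mul_sum]
  have h2 : (∑ t : Fin m, if β (Γ.arcOf (t - 1)) = true then (1 : ℕ) else 0) =
      ∑ t : Fin m, if β (Γ.arcOf t) = true then 1 else 0 :=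
    Equiv.sum_comp (Equiv.subRight (1 : Fin m)) (fun t => if β (Γ.arcOf t) = true then 1 else 0)
  rw [h2]
  unfold nSel
  rw [Finset.card_filter]
  ring

/-- All hubs are even, hence in `arcSet β`; so `nB (arcSet β) β = |β|`. [folklore] -/
theorem nB_arcSet (β : Fin 3 → Bool) : Γ.nB (Γ.arcSet β) β = (univ.filter fun a => β a = true).card := by
  unfold nB
  rw [← Finset.card_filter]
  have : (univ.filter fun p : Fin m × Bool =>
        (∃ i, β i = true ∧ p = (Γ.hub i, false)) ∧ p ∈ Γ.arcSet β) =
      (univ.filter fun a => β a = true).image fun i => (Γ.hub i, false) := by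
    ext p
    simp only [mem_filter, mem_univ, true_and, mem_image, mem_arcSet]
    constructor
    · rintro ⟨⟨i, hi, rfl⟩, -⟩; exact ⟨i, hi, rfl⟩
    · rintro ⟨i, hi, rfl⟩; exact ⟨⟨i, hi, rfl⟩, Or.inl rfl⟩
  rw [this, Finset.card_image_of_injective]
  intro i j h
  exact Γ.hub_injective (Prod.mk.inj h).1

/-! ### The parities of solutions of necklace instances -/

/-- The odd parity of an output, transported: `oddSum` is `nZ oddSet` mod `2`. [folklore] -/
theorem oddSum_cls (z : Fin N × Fin N → Bool) :
    oddSum Γ.cls (fun p => z (Γ.toFun p)) = (Γ.nZ (oddSet m) z : ZMod 2) := by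
  unfold oddSum nZ
  rw [Nat.cast_sum]
  refine Finset.sum_congr rfl fun p _ => ?_
  rw [Nat.cast_ite, Nat.cast_one, Nat.cast_zero]
  congr 1
  apply propext
  simp only [cls, mem_oddSet]
  constructor
  · rintro ⟨h1, h2⟩
    refine ⟨h2, ?_⟩
    by_contra h
    exact h1 (by simp [h])
  · rintro ⟨h1, h2⟩
    exact ⟨by simp [h2], h1⟩

/-- The setting-dependent parity of an output, transported: `arcSum β` is `nZ (arcSet β)` mod
`2`. [folklore] -/
theorem arcSum_cls (β : Fin 3 → Bool) (z : Fin N × Fin N → Bool) :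
    arcSum Γ.cls β (fun p => z (Γ.toFun p)) = (Γ.nZ (Γ.arcSet β) z : ZMod 2) := by
  unfold arcSum nZ
  rw [Nat.cast_sum]
  refine Finset.sum_congr rfl fun p _ => ?_
  rw [Nat.cast_ite, Nat.cast_one, Nat.cast_zero]
  congr 1
  apply propext
  simp only [cls, mem_arcSet]
  obtain ⟨t, b⟩ := p
  cases b <;> simp [and_comm]

/-- **Parities of HLF solutions on a necklace** (Bravyi–Gosset–König 2018, Claim 3, transported
to the 2D HLF problem). BGK Claim 3 states the parities `m_R m_B m_L = 1` and, for `|b|` even,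
`i^{|b|} m_u m_v m_w m_E m_R^{b_u} m_B^{b_v} m_L^{b_w} = 1` (Eq. (20)) for the measurement outcomes
`z ∈ 𝒯(b)`; by BGK Lemma 2 (used this way in §4.2 after Eq. (33)) `𝒯(b)` is exactly the set of
restrictions to `Γ` of the solutions of the instance `(A_Γ, b)` of Eq. (31). Here the conclusion
is proved directly for solutions: for every `z ∈ hlfSolutions (Γ.hlfInstance β)`, the restriction
of `z` to the necklace satisfies the constraints `GameOK` of `ShallowCircuitsGame` (which encode
exactly these two parities). [cite: BravyiGossetKonigScience2018, §4.1 Claim 3] -/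
theorem gameOK (β : Fin 3 → Bool) {z : Fin N × Fin N → Bool} (hz : z ∈ hlfSolutions (Γ.hlfInstance β)) :
    GameOK Γ.cls β (fun p => z (Γ.toFun p)) := by
  constructor
  · have h := Γ.solution_congr β (oddSet m) (Γ.nKer_oddSet_even β) hz
    rw [Γ.nE_oddSet, Γ.nB_oddSet] at h
    rw [Γ.oddSum_cls, ZMod.natCast_eq_zero_iff_even, Nat.even_iff]
    omega
  · intro hβ
    have h := Γ.solution_congr β (Γ.arcSet β) (Γ.nKer_arcSet_even β hβ) hz
    rw [Γ.nE_arcSet, Γ.nB_arcSet] at h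
    rw [Γ.arcSum_cls]
    have hle : (univ.filter fun a => β a = true).card ≤ 3 :=
      (Finset.card_filter_le _ _).trans (by simp)
    rw [Nat.even_iff] at hβ
    by_cases hex : ∃ a, β a = true
    · rw [if_pos hex, ZMod.natCast_eq_one_iff_odd, Nat.odd_iff]
      have hpos : 0 < (univ.filter fun a => β a = true).card := by
        obtain ⟨a, ha⟩ := hex
        exact Finset.card_pos.mpr ⟨a, by simp [ha]⟩
      omega
    · rw [if_neg hex, ZMod.natCast_eq_zero_iff_even, Nat.even_iff]
      have h0 : (univ.filter fun a => β a = true).card = 0 := by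
        rw [Finset.card_eq_zero, Finset.filter_eq_empty_iff]
        intro a _ ha
        exact hex ⟨a, ha⟩
      omega

end Necklace

/-! ### The input bits of the hubs -/

section InputBits

variable {r : ℕ}

/-- The position of the input bit `b_a` (`a` a grid vertex) in the input string of the classical
circuit: after the `2N(N-1)` edge bits, before the `r` random bits (`encodeHLF`, `Fin.append`).
(An indexing convention of `encodeHLF`; these are the input variables `b_v` of BGK §4.2.) [folklore] -/
def bIdx (N r : ℕ) (a : Fin N × Fin N) : Fin (inLen N + r) :=
  Fin.castAdd r (Fin.natAdd (N * (N - 1) + N * (N - 1)) (finProdFinEquiv a))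

/-- Distinct vertices have distinct `b`-bits. [folklore] -/
theorem bIdx_injective (N r : ℕ) : Function.Injective (bIdx N r) := by
  intro a a' h
  unfold bIdx at h
  exact finProdFinEquiv.injective (Fin.natAdd_injective _ _ (Fin.castAdd_injective _ _ h))

/-- The input string carries `b_a` at position `bIdx a`. [folklore] -/
theorem append_encodeHLF_bIdx (I : HLFInstance N) (ρ : Fin r → Bool) (a : Fin N × Fin N) :
    Fin.append (encodeHLF I) ρ (bIdx N r a) = I.b a := by
  rw [bIdx, Fin.append_left]
  unfold encodeHLF
  rw [Fin.append_right]
  simp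

/-- **Inputs of necklace instances differ only at the hub bits.** For two settings `β, β'` the
input strings of the instances `(A_Γ, β)` and `(A_Γ, β')` (same random bits) agree at every
position other than the bits `b_{hub a}` with `β a ≠ β' a` (BGK after Eq. (31): "There are 8 such
instances corresponding to choices of input bits `b_u, b_v, b_w`"; the statement about
`encodeHLF` is bookkeeping). [folklore] -/
theorem necklace_input_congr (Γ : Necklace N m) (ρ : Fin r → Bool)
    {β β' : Fin 3 → Bool} (i : Fin (inLen N + r))
    (hi : ∀ a, β a ≠ β' a → i ≠ bIdx N r (Γ.toFun (Γ.hub a, false))) :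
    Fin.append (encodeHLF (Γ.hlfInstance β)) ρ i = Fin.append (encodeHLF (Γ.hlfInstance β')) ρ i := by
  induction i using Fin.addCases with
  | left i =>
    rw [Fin.append_left, Fin.append_left]
    unfold encodeHLF
    induction i using Fin.addCases with
    | left k =>
      rw [Fin.append_left, Fin.append_left]
      rfl
    | right k =>
      rw [Fin.append_right, Fin.append_right]
      have key : ∀ a, β a ≠ β' a → Γ.toFun (Γ.hub a, false) ≠ finProdFinEquiv.symm k := by
        intro a ha hk
        apply hi a ha
        rw [bIdx, hk, Equiv.apply_symm_apply]
      rw [Bool.eq_iff_iff]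
      simp only [Necklace.hlfInstance, decide_eq_true_eq]
      constructor
      · rintro ⟨a, ha, hk⟩
        refine ⟨a, ?_, hk⟩
        by_contra hne
        exact key a (by rw [ha]; exact fun h => hne h.symm) hk
      · rintro ⟨a, ha, hk⟩
        refine ⟨a, ?_, hk⟩
        by_contra hne
        exact key a (by rw [ha]; exact hne) hk
  | right j =>
    rw [Fin.append_right, Fin.append_right]

end InputBits


end Literature.Computability.QuantumComplexity
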